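import Summits.AtomisticToContinuum.BoseEinsteinCondensation.Theorems.BECRieszReverseHolderGroundStateEnergyFinite
import Summits.AtomisticToContinuum.BoseEinsteinCondensation.Theorems.BECRieszReverseHolderCoarseGrainedReverseHolderStubSqSumDivLipschitz
import Summits.AtomisticToContinuum.BoseEinsteinCondensation.Theorems.BECRieszReverseHolderCoarseGrainedReverseHolderStubSliceLipschitzOf
import Summits.AtomisticToContinuum.BoseEinsteinCondensation.Theorems.BECRieszReverseHolderCoarseGrainedReverseHolderStubNearMinimiserNearGroundState
import Summits.AtomisticToContinuum.BoseEinsteinCondensation.Theorems.BECRieszReverseHolderCoarseGrainedReverseHolderStubBosecornerOfFieldMoment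
import HarnessLib

/-!
# Route `BECRieszReverseHolder`, crux `CoarseGrainedReverseHolder` (stmt-AtomisticToContinuum-12840):
# reduction of the crux to non-negative GROUND STATES

Supports (does not close) stmt-AtomisticToContinuum-12840 (line `registered`,
`Cruxes/CoarseGrainedReverseHolder/Lines/registered.lean`). The crux asks for a bound, uniform in
`N = n + 1`, on the coarse-grained reverse-Hölder functional
`F_{n,ℓ}(Ψ) = m³ ∫ dX̂ Σ_Q (∫_Q |Ψ(y,X̂)|² dy)² / ∫ |Ψ(y,X̂)|² dy` (`m = ⌊L/ℓ⌋`, cubes `Q` of side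
`L/m`) over all NON-NEGATIVE `δ`-near-minimisers `Ψ` of the Dirichlet `N`-boson energy, `δ = δ(N)`
chosen after `N`. This file kernel-checks the first layer of the line:

* `coarseGrainedReverseHolder_of_groundStates` — **it suffices to bound `F_{n,ℓ}` on non-negative
  ground states** (`BoseGas.IsGroundState`, `Φ = ‖Φ‖` pointwise), eventually in `n`: the four landed
  stubs `stub_nearMinimiserNearGroundState` (compactness: every non-negative `δ`-near-minimiser is
  `L²`-close to some non-negative ground state, `δ` after `N`), `stub_sliceLipschitz_of ∘
  stub_sqSumDivLipschitz` (`F_{n,ℓ}` is `L²`-Lipschitz: `F(Ψ) ≤ F(Φ) + 8m³η` for `‖Ψ − Φ‖₂ ≤ η`) and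
  the proved route support `GroundStateEnergyFinite` give the crux with constant `C + 1`
  (tolerance `η₀ = 1/(8m³ + 8)` at each `n`).
* (the converse — the crux bounds `F_{n,ℓ}` on non-negative ground states with the same constant, so
  the reduction loses nothing — is `groundStates_of_coarseGrainedReverseHolder` in the companion file
  `BECRieszReverseHolderCoarseGrainedReverseHolderGroundStateEquivalence.lean`.)
* `coarseGrainedReverseHolder_of_shadowDomination` — the registered composition with its two open
  stubs as hypotheses: shadow domination of non-negative ground states (`stub_groundStateShadowDomination`,
  the typed Bose–Riesz membership, informal route item stmt-AtomisticToContinuum-12602) together with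
  the route crux `RieszShadowFieldMoment` (stmt-AtomisticToContinuum-12841, through the landed corner
  extraction `stub_bosecornerOfFieldMoment`) implies `CoarseGrainedReverseHolder`.
-/

noncomputable section

open MeasureTheory Filter Matrix
open scoped ENNReal NNReal BigOperators

namespace Summit.AtomisticToContinuum.BoseEinsteinCondensation.Theorems.CoarseGrainedReverseHolder

open Literature.MathematicalPhysics.QuantumManyBody
open Summit.AtomisticToContinuum.BoseEinsteinCondensation.Theses.BECRieszReverseHolder

/-- **Reduction of the crux to non-negative ground states.** If for every admissible `v`, all small
`ρ` and every resolution `ℓ > 0` there is `C` such that, eventually in `n`, every non-negative ground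
state `Φ` of `n + 1` bosons in the Dirichlet box of side `L = ((n+1)/ρ)^{1/3}` has
`F_{n,ℓ}(Φ) ≤ C`, then `CoarseGrainedReverseHolder` holds (with constant `max C 0 + 1`): at each large
`n` the ground-state energy is finite (`GroundStateEnergyFinite`, proved), so for the tolerance
`η₀ = 1/(8m³+8)` compactness (`stub_nearMinimiserNearGroundState`) provides `δ > 0` such that every
non-negative `δ`-near-minimiser `Ψ` is `η₀`-close in `L²` to a non-negative ground state `Φ`, and the
`L²`-Lipschitz estimate (`stub_sliceLipschitz_of stub_sqSumDivLipschitz`) gives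
`F(Ψ) ≤ F(Φ) + 8m³η₀ ≤ C + 1`. -/
theorem coarseGrainedReverseHolder_of_groundStates
    (hGS : ∀ v : ℝ → ENNReal, BoseGas.IsRepulsiveFiniteRange v →
      ∃ ρ₀ : ℝ, 0 < ρ₀ ∧ ∀ ρ : ℝ, 0 < ρ → ρ < ρ₀ → ∀ ℓ : ℝ, 0 < ℓ → ∃ C : ℝ,
      ∀ᶠ n : ℕ in Filter.atTop,
        ∀ Φ : BoseGas.Config (n + 1) → ℂ,
          BoseGas.IsGroundState v (BoseGas.sideLength ρ (n + 1)) Φ → (∀ X, Φ X = (‖Φ X‖ : ℂ)) →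
          let L := BoseGas.sideLength ρ (n + 1)
          let m := ⌊L / ℓ⌋₊
          (m : ENNReal) ^ 3 * ∫⁻ X : Fin n → EuclideanSpace ℝ (Fin 3),
              ((∑ k : Fin 3 → Fin m,
                  (∫⁻ y in {y : EuclideanSpace ℝ (Fin 3) |
                      ∀ i, y i ∈ Set.Ico ((k i : ℝ) * (L / m)) (((k i : ℝ) + 1) * (L / m))},
                    (‖Φ (Matrix.vecCons y X)‖₊ : ENNReal) ^ 2) ^ 2) /
                (∫⁻ y, (‖Φ (Matrix.vecCons y X)‖₊ : ENNReal) ^ 2))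
            ≤ ENNReal.ofReal C) :
    CoarseGrainedReverseHolder := by
  intro v hv
  obtain ⟨ρ₁, hρ₁, h1⟩ := Theorems.groundStateEnergyFinite_proof v hv
  obtain ⟨ρ₂, hρ₂, h2⟩ := hGS v hv
  refine ⟨min ρ₁ ρ₂, lt_min hρ₁ hρ₂, fun ρ hρ hρlt ℓ hℓ => ?_⟩
  have hρ₁' : ρ < ρ₁ := hρlt.trans_le (min_le_left _ _)
  have hρ₂' : ρ < ρ₂ := hρlt.trans_le (min_le_right _ _)
  obtain ⟨C, hC⟩ := h2 ρ hρ hρ₂' ℓ hℓ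
  refine ⟨max C 0 + 1, ?_⟩
  -- finiteness of the ground-state energy, shifted to `N = n + 1`
  have h1' : ∀ᶠ n : ℕ in Filter.atTop,
      BoseGas.groundStateEnergy v (n + 1) (BoseGas.sideLength ρ (n + 1)) ≠ ⊤ :=
    (tendsto_add_atTop_nat 1).eventually (h1 ρ hρ hρ₁')
  filter_upwards [h1', hC] with n hEn hCn
  -- the Lipschitz tolerance `η₀ = 1 / (8 m³ + 8)` at this `n`
  have hK : (0 : ℝ) < 8 * ((⌊BoseGas.sideLength ρ (n + 1) / ℓ⌋₊ : ℕ) : ℝ) ^ 3 + 8 := by positivity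
  have hη₀ : (0 : ℝ) < 1 / (8 * ((⌊BoseGas.sideLength ρ (n + 1) / ℓ⌋₊ : ℕ) : ℝ) ^ 3 + 8) := by
    positivity
  obtain ⟨δ, hδ, hδP⟩ := stub_nearMinimiserNearGroundState v (n + 1) (BoseGas.sideLength ρ (n + 1))
    hEn ((1 / (8 * ((⌊BoseGas.sideLength ρ (n + 1) / ℓ⌋₊ : ℕ) : ℝ) ^ 3 + 8)) ^ 2) (by positivity)
  refine ⟨δ, hδ, fun Ψ hΨE hΨpos => ?_⟩
  obtain ⟨Φ, hΦgs, hΦpos, hclose⟩ := hδP Ψ hΨE hΨpos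
  have key := stub_sliceLipschitz_of stub_sqSumDivLipschitz n (BoseGas.sideLength ρ (n + 1))
    (1 / (8 * ((⌊BoseGas.sideLength ρ (n + 1) / ℓ⌋₊ : ℕ) : ℝ) ^ 3 + 8)) hη₀.le Ψ Φ hΦgs.measurable
    hΦgs.norm_eq hclose (⌊BoseGas.sideLength ρ (n + 1) / ℓ⌋₊)
  have hΦF := hCn Φ hΦgs hΦpos
  dsimp only at hΦF ⊢
  refine key.trans ?_
  have hreal : 8 * ((⌊BoseGas.sideLength ρ (n + 1) / ℓ⌋₊ : ℕ) : ℝ) ^ 3 *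
      (1 / (8 * ((⌊BoseGas.sideLength ρ (n + 1) / ℓ⌋₊ : ℕ) : ℝ) ^ 3 + 8)) ≤ 1 :=
    calc 8 * ((⌊BoseGas.sideLength ρ (n + 1) / ℓ⌋₊ : ℕ) : ℝ) ^ 3 *
          (1 / (8 * ((⌊BoseGas.sideLength ρ (n + 1) / ℓ⌋₊ : ℕ) : ℝ) ^ 3 + 8))
          ≤ (8 * ((⌊BoseGas.sideLength ρ (n + 1) / ℓ⌋₊ : ℕ) : ℝ) ^ 3 + 8) *
            (1 / (8 * ((⌊BoseGas.sideLength ρ (n + 1) / ℓ⌋₊ : ℕ) : ℝ) ^ 3 + 8)) :=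
            mul_le_mul_of_nonneg_right (by linarith) hη₀.le
      _ = 1 := mul_one_div_cancel hK.ne'
  calc _ ≤ ENNReal.ofReal (max C 0) + ENNReal.ofReal 1 :=
        add_le_add (hΦF.trans (ENNReal.ofReal_le_ofReal (le_max_left _ _)))
          (ENNReal.ofReal_le_ofReal hreal)
    _ = ENNReal.ofReal (max C 0 + 1) := by
        rw [ENNReal.ofReal_add (le_max_right _ _) zero_le_one]


/-- **The registered composition, with its two open stubs as hypotheses.** Shadow domination of
non-negative ground states (`hS3`, verbatim the registered stub `stub_groundStateShadowDomination` of
line `registered`: `F_{n,ℓ}(Φ) ≤ A · (1 + S_n)` for every non-negative ground state `Φ`, `S_n` the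
supremum over `y` of the `θ = 2` cavity-field exponential moment of the shadow smeared Riesz-2 gas in
the Bose dictionary) and the route crux `RieszShadowFieldMoment` (stmt-AtomisticToContinuum-12841)
imply `CoarseGrainedReverseHolder`: the landed corner extraction `stub_bosecornerOfFieldMoment` bounds
`S_n ≤ C` eventually in `n`, so non-negative ground states obey `F ≤ max A 0 · (1 + max C 0)`, and
`coarseGrainedReverseHolder_of_groundStates` concludes. -/
theorem coarseGrainedReverseHolder_of_shadowDomination
    (hS3 : ∀ v : ℝ → ENNReal, BoseGas.IsRepulsiveFiniteRange v →
      ∃ ρ₀ : ℝ, 0 < ρ₀ ∧ ∀ ρ : ℝ, 0 < ρ → ρ < ρ₀ → ∀ ℓ : ℝ, 0 < ℓ → ∃ A : ℝ,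
      ∀ᶠ n : ℕ in Filter.atTop,
        ∀ (L : ℝ), L = BoseGas.sideLength ρ (n + 1) →
        ∀ (m : ℕ), m = ⌊L / ℓ⌋₊ →
        ∀ (a : ℝ), a = (BoseGas.scatteringLength v).toReal →
        ∀ (b : ℝ), b = 2 * Real.pi ^ (-(3 / 2 : ℝ)) * (a / ρ) ^ (1 / 2 : ℝ) →
        ∀ (η : ℝ), η = max ((8 * Real.pi * ρ * a) ^ (-(1 / 2 : ℝ))) (ρ ^ (-(1 / 3 : ℝ))) →
        ∀ (g : BoseGas.Space → ℝ), g = (fun x =>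
          2 * Real.pi ^ (3 / 2 : ℝ) * ∫ t in Set.Ioi (η ^ 2), t ^ (-(1 / 2 : ℝ)) *
            ((∑' mm : Fin 3 → ℤ, Literature.Analysis.UnboundedOperators.heatKernel t
              (x - BoseGas.latticeVec L mm)) - 1 / L ^ 3)) →
        ∀ (H : BoseGas.Config n → ℝ), H = (fun X => ∑ i : Fin n, ∑ j : Fin n with i < j, g (X i - X j)) →
        ∀ Φ : BoseGas.Config (n + 1) → ℂ, BoseGas.IsGroundState v L Φ → (∀ X, Φ X = (‖Φ X‖ : ℂ)) →
          (m : ENNReal) ^ 3 * ∫⁻ X : Fin n → EuclideanSpace ℝ (Fin 3),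
              ((∑ k : Fin 3 → Fin m,
                  (∫⁻ y in {y : EuclideanSpace ℝ (Fin 3) |
                      ∀ i, y i ∈ Set.Ico ((k i : ℝ) * (L / m)) (((k i : ℝ) + 1) * (L / m))},
                    (‖Φ (Matrix.vecCons y X)‖₊ : ENNReal) ^ 2) ^ 2) /
                (∫⁻ y, (‖Φ (Matrix.vecCons y X)‖₊ : ENNReal) ^ 2))
            ≤ ENNReal.ofReal A * (1 +
              ⨆ y : BoseGas.Space,
                (∫⁻ X in BoseGas.cellN n L,
                    ENNReal.ofReal (Real.exp (-(b * H X) - 2 * b * ∑ j : Fin n, g (y - X j)))) /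
                (∫⁻ X in BoseGas.cellN n L, ENNReal.ofReal (Real.exp (-(b * H X))))))
    (hR : RieszShadowFieldMoment) :
    CoarseGrainedReverseHolder := by
  refine coarseGrainedReverseHolder_of_groundStates fun v hv => ?_
  obtain ⟨ρ₂, hρ₂, h2⟩ := hS3 v hv
  obtain ⟨ρ₃, hρ₃, h3⟩ := stub_bosecornerOfFieldMoment hR v hv
  refine ⟨min ρ₂ ρ₃, lt_min hρ₂ hρ₃, fun ρ hρ hρlt ℓ hℓ => ?_⟩
  have hρ₂' : ρ < ρ₂ := hρlt.trans_le (min_le_left _ _)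
  have hρ₃' : ρ < ρ₃ := hρlt.trans_le (min_le_right _ _)
  obtain ⟨A, hA⟩ := h2 ρ hρ hρ₂' ℓ hℓ
  obtain ⟨C, hC⟩ := h3 ρ hρ hρ₃'
  refine ⟨max A 0 * (1 + max C 0), ?_⟩
  filter_upwards [hA, hC] with n hAn hCn
  intro Φ hΦgs hΦpos
  -- the dictionary binders instantiated by `rfl`
  have hΦF := hAn _ rfl _ rfl _ rfl _ rfl _ rfl _ rfl _ rfl Φ hΦgs hΦpos
  have hCn' := hCn _ rfl _ rfl _ rfl _ rfl _ rfl _ rfl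
  dsimp only at hΦF hCn' ⊢
  calc _ ≤ ENNReal.ofReal (max A 0) * (1 + ENNReal.ofReal (max C 0)) := by
        refine hΦF.trans ?_
        gcongr ENNReal.ofReal ?_ * (1 + ?_)
        · exact le_max_left _ _
        · exact hCn'.trans (ENNReal.ofReal_le_ofReal (le_max_left _ _))
    _ = ENNReal.ofReal (max A 0 * (1 + max C 0)) := by
        rw [ENNReal.ofReal_mul (le_max_right _ _), ENNReal.ofReal_add zero_le_one (le_max_right _ _),
          ENNReal.ofReal_one]

/-- **Registered sub-goal `stub_cruxOfGroundStateBound` of crux stmt-AtomisticToContinuum-12840 (line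
`registered`, first layer)**: a uniform bound on `F_{n,ℓ}` over non-negative ground states implies
`CoarseGrainedReverseHolder` — `coarseGrainedReverseHolder_of_groundStates` under its registered name. -/
theorem stub_cruxOfGroundStateBound : (∀ v : ℝ → ENNReal, BoseGas.IsRepulsiveFiniteRange v → ∃ ρ₀ : ℝ, 0 < ρ₀ ∧ ∀ ρ : ℝ, 0 < ρ → ρ < ρ₀ → ∀ ℓ : ℝ, 0 < ℓ → ∃ C : ℝ, ∀ᶠ n : ℕ in Filter.atTop, ∀ Φ : BoseGas.Config (n + 1) → ℂ, BoseGas.IsGroundState v (BoseGas.sideLength ρ (n + 1)) Φ → (∀ X, Φ X = (‖Φ X‖ : ℂ)) → let L := BoseGas.sideLength ρ (n + 1); let m := ⌊L / ℓ⌋₊; (m : ENNReal) ^ 3 * ∫⁻ X : Fin n → EuclideanSpace ℝ (Fin 3), ((∑ k : Fin 3 → Fin m, (∫⁻ y in {y : EuclideanSpace ℝ (Fin 3) | ∀ i, y i ∈ Set.Ico ((k i : ℝ) * (L / m)) (((k i : ℝ) + 1) * (L / m))}, (‖Φ (Matrix.vecCons y X)‖₊ : ENNReal) ^ 2) ^ 2)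 / (∫⁻ y, (‖Φ (Matrix.vecCons y X)‖₊ : ENNReal) ^ 2)) ≤ ENNReal.ofReal C) → CoarseGrainedReverseHolder :=
  coarseGrainedReverseHolder_of_groundStates

end Summit.AtomisticToContinuum.BoseEinsteinCondensation.Theorems.CoarseGrainedReverseHolder

end
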